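import Mathlib.FieldTheory.Minpoly.Finite
import Mathlib.Algebra.Group.Nat.Hom
import Literature.AlgebraicGeometry.Frobenioids.PadicValuativeEndomorphisms
import HarnessLib

/-!
# Frobenioids II, Example 1.1 (i): `ord(O_K^⊳) ≅ ℤ_{≥0}` for a finite extension `K` of `ℚ_p` (PROOFS)

Mochizuki, *The geometry of Frobenioids II*, Kyushu J. Math. **62** (2008) 401–460, §1, Example 1.1 (i)
pp. 7–8: for "`Spec(K) ∈ Ob(D₀)` [i.e., `K` is a finite extension of `ℚ_p`]", `ord(O_K^⊳) := O_K^⊳/O_K^×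
⊆ ord(K^×) := K^×/O_K^×`, with "`ord(V) := V/O_K^× (≅ ℤ)`" (p. 8) — the valuation of `K` is DISCRETE of
rank one, i.e. `ord(O_K^⊳) ≅ ℤ_{≥0}` is `ℤ`-monoprime in the sense of [FrdI] §0
[cite: MochizukiFrdII2008, Ex 1.1 (i) p.7].

PROOF-ONLY companion: for `K` with a finite `ℚ_p`-algebra structure along which its valuative relation
restricts to the `p`-adic one (abc-iut-L1-t4's `PadicFld.IsPadicLocal`, unbundled) we prove
`IsZMonoprime (OrdInt K)` (`isZMonoprime_ordInt`), hence `IsMonoprime (OrdInt K)` — the hypothesis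
`hmono` of t4's `PadicFrd.Datum.zero` (the datum of the `p`-adic Frobenioid `C₀` over a base `D → D₀`),
proved by t4 for `K = ℚ_p` only (`isZMonoprime_ordInt_padic`). Route ("finite index of value groups",
elementary): by `PadicValuativeEndomorphisms` every `v(x)` satisfies `v(x)^n = v(p)^k` with
`1 ≤ n ≤ [K : ℚ_p]` (here re-proved with the bound), so with `N := [K : ℚ_p]!` there is a well-defined
additive exponent `e(x) ∈ ℤ`, `v(x)^N = v(p)^{e(x)}`, multiplicative in `x`, `≥ 0` exactly on `O_K^⊳` and
`= 0` exactly on `O_K^×`; an element `π` with `v(π) < 1` and `e(π)` minimal is a uniformizer: `e(π) ∣ e(x)`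
for all `x` (Euclidean division + minimality), whence every `x ∈ O_K^⊳` is `π^k` times a unit with `k`
unique, i.e. `k ↦ [π]^k` is a bijection `ℤ_{≥0} ≅ ord(O_K^⊳)`. No definitions; nothing here bears on
[IUTchIII].
-/

namespace Literature.AlgebraicGeometry.Frobenioids

namespace PadicFrd

open ValuativeRel Polynomial

universe u

section PadicLocal

variable {p : ℕ} [Fact p.Prime] {K : Type u} [Field K] [ValuativeRel K] [Algebra ℚ_[p] K]

/-- `v_K(p) < 1` along a compatible `ℚ_p`-algebra structure. [cite: MochizukiFrdII2008, Ex 1.1 (i) p.7] -/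
theorem valuation_p_lt_one
    (hc : ∀ a b : ℚ_[p], algebraMap ℚ_[p] K a ≤ᵥ algebraMap ℚ_[p] K b ↔ a ≤ᵥ b) :
    valuation K ((p : ℕ) : K) < 1 := by
  have h : ¬ ((1 : ℚ_[p]) ≤ᵥ ((p : ℕ) : ℚ_[p])) := by
    rw [(valuation ℚ_[p]).vle_iff_le, map_one, not_le]
    exact Padic.valuation_p_lt_one _
  have h' : ¬ (algebraMap ℚ_[p] K 1 ≤ᵥ algebraMap ℚ_[p] K ((p : ℕ) : ℚ_[p])) := fun hh => h ((hc _ _).mp hh)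
  rw [map_one, map_natCast, (valuation K).vle_iff_le, map_one, not_le] at h'
  exact h'

/-- In `ord(O_K^⊳) = O_K^⊳/O_K^×` two classes coincide iff the valuations coincide (units of `O_K^⊳` are the
elements of valuation `1`). [cite: MochizukiFrdII2008, Ex 1.1 (i) p.7] -/
theorem associatesMk_eq_iff_valuation_eq (x y : intNonzero K) :
    Associates.mk x = Associates.mk y ↔ valuation K (x : K) = valuation K (y : K) := by
  rw [Associates.mk_eq_mk_iff_associated]
  constructor
  · rintro ⟨u, rfl⟩
    have hu : valuation K ((u : intNonzero K) : K) = 1 := (isUnit_intNonzero_iff K _).mp u.isUnit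
    rw [Submonoid.coe_mul, map_mul, hu, mul_one]
  · intro h
    have hx0 : valuation K (x : K) ≠ 0 := (Valuation.ne_zero_iff _).mpr x.2.2
    have hq : valuation K ((y : K) / x) = 1 := by rw [map_div₀, h, div_self (h ▸ hx0)]
    have hmem : (y : K) / x ∈ intNonzero K := ⟨hq.le, div_ne_zero y.2.2 x.2.2⟩
    obtain ⟨u, hu⟩ := (isUnit_intNonzero_iff K ⟨_, hmem⟩).mpr hq
    exact ⟨u, Subtype.ext (by rw [Submonoid.coe_mul, hu]; exact mul_div_cancel₀ _ x.2.2)⟩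

variable [Module.Finite ℚ_[p] K]

/-- `PadicValuativeEndomorphisms.exists_pow_valuation_eq_zpow` WITH THE BOUND `n ≤ [K : ℚ_p]`: for `x ∈ K^×`
some `v(x)^n`, `1 ≤ n ≤ [K : ℚ_p]`, is an integral power of `v(p)` (the two terms of equal valuation in the
minimal equation have indices `≤ deg(minpoly) ≤ [K : ℚ_p]`). [cite: MochizukiFrdII2008, Ex 1.1 (i) p.7] -/
theorem exists_pow_valuation_eq_zpow_le
    (hc : ∀ a b : ℚ_[p], algebraMap ℚ_[p] K a ≤ᵥ algebraMap ℚ_[p] K b ↔ a ≤ᵥ b) {x : K} (hx : x ≠ 0) :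
    ∃ n : ℕ, 0 < n ∧ n ≤ Module.finrank ℚ_[p] K ∧
      ∃ k : ℤ, valuation K x ^ n = valuation K ((p : ℕ) : K) ^ k := by
  classical
  set f : ℚ_[p][X] := minpoly ℚ_[p] x with hf
  have hint : _root_.IsIntegral ℚ_[p] x := Algebra.IsIntegral.isIntegral x
  have hmonic : f.Monic := minpoly.monic hint
  have hdeg : f.natDegree ≤ Module.finrank ℚ_[p] K := minpoly.natDegree_le x
  set t : ℕ → K := fun i => algebraMap ℚ_[p] K (f.coeff i) * x ^ i with ht
  set s : Finset ℕ := Finset.range (f.natDegree + 1) with hs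
  have hsum : ∑ i ∈ s, t i = 0 := by
    have h := minpoly.aeval ℚ_[p] x
    rw [aeval_eq_sum_range] at h
    simpa only [Algebra.smul_def] using h
  have hmem : ∀ i ∈ s, i ≤ f.natDegree := fun i hi => by
    rw [hs, Finset.mem_range] at hi
    exact Nat.lt_succ_iff.mp hi
  have hd : f.natDegree ∈ s := by rw [hs, Finset.mem_range]; exact Nat.lt_succ_self _
  have htd : valuation K (t f.natDegree) ≠ 0 := by
    rw [ht]
    simp only [hmonic.coeff_natDegree, map_one, one_mul, map_pow]
    exact pow_ne_zero _ ((Valuation.ne_zero_iff _).mpr hx)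
  obtain ⟨j, hj, hmax⟩ := Finset.exists_max_image s (fun i => valuation K (t i)) ⟨f.natDegree, hd⟩
  have htj : valuation K (t j) ≠ 0 := fun h0 => htd (le_antisymm (h0 ▸ hmax _ hd) zero_le)
  have key : ∃ i ∈ s, i ≠ j ∧ valuation K (t i) = valuation K (t j) := by
    by_contra hne
    have hlt : ∀ i ∈ s \ {j}, valuation K (t i) < valuation K (t j) := fun i hi => by
      rw [Finset.mem_sdiff, Finset.mem_singleton] at hi
      exact lt_of_le_of_ne (hmax i hi.1) fun heq => hne ⟨i, hi.1, hi.2, heq⟩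
    have h := Valuation.map_sum_eq_of_lt (valuation K) hj hlt
    rw [hsum, map_zero] at h
    exact htj h.symm
  obtain ⟨i, hi, hij, hti⟩ := key
  have hcj : f.coeff j ≠ 0 := fun h0 => htj (by rw [ht]; simp only [h0, map_zero, zero_mul])
  have hti' : valuation K (t i) ≠ 0 := hti ▸ htj
  have hci : f.coeff i ≠ 0 := fun h0 => hti' (by rw [ht]; simp only [h0, map_zero, zero_mul])
  have hvx : valuation K x ≠ 0 := (Valuation.ne_zero_iff _).mpr hx
  have hvp : valuation K ((p : ℕ) : K) ≠ 0 := (Valuation.ne_zero_iff _).mpr natCast_p_ne_zero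
  have heq : valuation K ((p : ℕ) : K) ^ (f.coeff i).valuation * valuation K x ^ i =
      valuation K ((p : ℕ) : K) ^ (f.coeff j).valuation * valuation K x ^ j := by
    rw [← valuation_algebraMap_eq_zpow hc hci, ← valuation_algebraMap_eq_zpow hc hcj, ← map_pow,
      ← map_pow, ← map_mul, ← map_mul]
    exact hti
  have hi' := hmem i hi
  have hj' := hmem j hj
  rcases Nat.lt_or_gt_of_ne hij with hlt | hlt
  · obtain ⟨n, hn⟩ := Nat.exists_eq_add_of_lt hlt
    obtain rfl : j = i + (n + 1) := by omega
    refine ⟨n + 1, Nat.succ_pos n, by omega, (f.coeff i).valuation - (f.coeff (i + (n + 1))).valuation, ?_⟩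
    rw [pow_add, mul_comm (valuation K x ^ i), ← mul_assoc] at heq
    have h2 := mul_right_cancel₀ (pow_ne_zero _ hvx) heq
    rw [zpow_sub₀ hvp, eq_div_iff (zpow_ne_zero _ hvp), h2, mul_comm]
  · obtain ⟨n, hn⟩ := Nat.exists_eq_add_of_lt hlt
    obtain rfl : i = j + (n + 1) := by omega
    refine ⟨n + 1, Nat.succ_pos n, by omega, (f.coeff j).valuation - (f.coeff (j + (n + 1))).valuation, ?_⟩
    rw [pow_add, mul_comm (valuation K x ^ j), ← mul_assoc] at heq
    have h2 := mul_right_cancel₀ (pow_ne_zero _ hvx) heq.symm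
    rw [zpow_sub₀ hvp, eq_div_iff (zpow_ne_zero _ hvp), h2, mul_comm]

/-- Uniform exponent: with `N := [K : ℚ_p]!`, every `v(x)^N` (`x ≠ 0`) is an integral power of `v(p)`.
[cite: MochizukiFrdII2008, Ex 1.1 (i) p.7] -/
theorem exists_valuation_pow_factorial_eq_zpow
    (hc : ∀ a b : ℚ_[p], algebraMap ℚ_[p] K a ≤ᵥ algebraMap ℚ_[p] K b ↔ a ≤ᵥ b) {x : K} (hx : x ≠ 0) :
    ∃ m : ℤ, valuation K x ^ (Module.finrank ℚ_[p] K).factorial = valuation K ((p : ℕ) : K) ^ m := by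
  obtain ⟨n, hn, hnN, k, hk⟩ := exists_pow_valuation_eq_zpow_le hc hx
  obtain ⟨c, hcn⟩ := Nat.dvd_factorial hn hnN
  refine ⟨k * c, ?_⟩
  rw [hcn, pow_mul, hk, ← zpow_natCast, ← zpow_mul]

/-- **`ord(O_K^⊳) ≅ ℤ_{≥0}`** ("`ord(V) := V/O_K^× (≅ ℤ)`", FrdII p. 8): for `K` a finite extension of `ℚ_p`
with its `p`-adic valuation, the monoid `ord(O_K^⊳) = O_K^⊳/O_K^×` is `ℤ`-monoprime ([FrdI] §0), i.e. the
valuation is discrete of rank one: there is a uniformizer `π` such that `k ↦ [π]^k` is a bijection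
`ℤ_{≥0} → ord(O_K^⊳)`. [cite: MochizukiFrdII2008, Ex 1.1 (i) p.7] -/
theorem isZMonoprime_ordInt
    (hc : ∀ a b : ℚ_[p], algebraMap ℚ_[p] K a ≤ᵥ algebraMap ℚ_[p] K b ↔ a ≤ᵥ b) :
    IsZMonoprime (OrdInt K) := by
  classical
  set N := (Module.finrank ℚ_[p] K).factorial with hN
  have hN0 : N ≠ 0 := Nat.factorial_ne_zero _
  have hvp : valuation K ((p : ℕ) : K) ≠ 0 := (Valuation.ne_zero_iff _).mpr natCast_p_ne_zero
  have hvp0 : 0 < valuation K ((p : ℕ) : K) := zero_lt_iff.mpr hvp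
  have hvp1 : valuation K ((p : ℕ) : K) < 1 := valuation_p_lt_one hc
  -- the exponent `e(x)`: `v(x)^N = v(p)^{e(x)}`
  have hexp : ∀ x : K, x ≠ 0 → ∃ m : ℤ, valuation K x ^ N = valuation K ((p : ℕ) : K) ^ m :=
    fun x hx => exists_valuation_pow_factorial_eq_zpow hc hx
  choose! e he using hexp
  have he_eq : ∀ x y : K, x ≠ 0 → y ≠ 0 → (valuation K x = valuation K y ↔ e x = e y) := by
    intro x y hx hy
    constructor
    · intro h
      apply zpow_right_injective₀ hvp0 hvp1.ne
      dsimp only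
      rw [← he x hx, ← he y hy, h]
    · intro h
      have hxy := he x hx
      rw [h, ← he y hy] at hxy
      exact (pow_left_inj₀ zero_le zero_le hN0).mp hxy
  have he_lt : ∀ x : K, x ≠ 0 → (valuation K x < 1 ↔ 0 < e x) := by
    intro x hx
    rw [← zpow_lt_one_iff_right_of_lt_one₀ hvp0 hvp1, ← he x hx, pow_lt_one_iff_of_nonneg zero_le hN0]
  have he_le : ∀ x : K, x ≠ 0 → (valuation K x ≤ 1 ↔ 0 ≤ e x) := by
    intro x hx
    rw [← zpow_le_one_iff_right_of_lt_one₀ hvp0 hvp1, ← he x hx, pow_le_one_iff_of_nonneg zero_le hN0]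
  have he_mul : ∀ x y : K, x ≠ 0 → y ≠ 0 → e (x * y) = e x + e y := by
    intro x y hx hy
    apply zpow_right_injective₀ hvp0 hvp1.ne
    dsimp only
    rw [← he _ (mul_ne_zero hx hy), map_mul, mul_pow, he x hx, he y hy, zpow_add₀ hvp]
  have he_pow : ∀ (x : K), x ≠ 0 → ∀ k : ℕ, e (x ^ k) = k * e x := by
    intro x hx k
    induction k with
    | zero =>
      apply zpow_right_injective₀ hvp0 hvp1.ne
      dsimp only
      rw [← he _ (pow_ne_zero _ hx), pow_zero, map_one, one_pow, Nat.cast_zero, zero_mul, zpow_zero]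
    | succ k ih => rw [pow_succ, he_mul _ _ (pow_ne_zero _ hx) hx, ih, Nat.cast_succ, add_mul, one_mul]
  have he_zpow : ∀ (x : K), x ≠ 0 → ∀ k : ℤ, e (x ^ k) = k * e x := by
    intro x hx k
    rcases Int.eq_nat_or_neg k with ⟨n, rfl | rfl⟩
    · rw [zpow_natCast, he_pow x hx n]
    · have h := he_mul (x ^ (n : ℤ)) (x ^ (-(n : ℤ))) (zpow_ne_zero _ hx) (zpow_ne_zero _ hx)
      rw [← zpow_add₀ hx, add_neg_cancel, zpow_zero, zpow_natCast, he_pow x hx n] at h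
      have h1 : e (1 : K) = 0 := by
        have := he_mul 1 1 one_ne_zero one_ne_zero
        rw [mul_one] at this
        omega
      rw [h1] at h
      rw [neg_mul]
      omega
  -- a uniformizer: `v(π) < 1` with `e(π)` minimal
  have hp0 : ((p : ℕ) : K) ≠ 0 := natCast_p_ne_zero
  have hP : ∃ n : ℕ, ∃ x : K, x ≠ 0 ∧ valuation K x < 1 ∧ (e x).toNat = n :=
    ⟨_, _, hp0, hvp1, rfl⟩
  obtain ⟨π, hπ0, hπ1, hπe⟩ := Nat.find_spec hP
  have heπ : 0 < e π := (he_lt π hπ0).mp hπ1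
  have hmin : ∀ y : K, y ≠ 0 → valuation K y < 1 → e π ≤ e y := by
    intro y hy hy1
    have h := Nat.find_min' hP ⟨y, hy, hy1, rfl⟩
    rw [← hπe] at h
    have hey : 0 < e y := (he_lt y hy).mp hy1
    omega
  -- `e(π)` divides every exponent
  have hdvd : ∀ x : K, x ≠ 0 → e π ∣ e x := by
    intro x hx
    by_contra hnd
    set q := e x / e π with hq
    set r := e x % e π with hr
    have hdiv : r + e π * q = e x := Int.emod_add_mul_ediv _ _
    have hr0 : 0 ≤ r := Int.emod_nonneg _ heπ.ne'
    have hrlt : r < e π := Int.emod_lt_of_pos _ heπ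
    have hrne : r ≠ 0 := fun h0 => hnd (Int.dvd_of_emod_eq_zero h0)
    have hy0 : x * π ^ (-q) ≠ 0 := mul_ne_zero hx (zpow_ne_zero _ hπ0)
    have hey : e (x * π ^ (-q)) = r := by
      rw [he_mul _ _ hx (zpow_ne_zero _ hπ0), he_zpow π hπ0, neg_mul, mul_comm q (e π)]
      omega
    have hy1 : valuation K (x * π ^ (-q)) < 1 := by
      rw [he_lt _ hy0, hey]
      omega
    have := hmin _ hy0 hy1
    rw [hey] at this
    omega
  -- the bijection `k ↦ [π]^k`
  let ϖ : intNonzero K := ⟨π, hπ1.le, hπ0⟩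
  have hvπ0 : 0 < valuation K π := zero_lt_iff.mpr ((Valuation.ne_zero_iff _).mpr hπ0)
  refine ⟨⟨(MulEquiv.ofBijective (powersHom (OrdInt K) (Associates.mk ϖ)) ⟨?_, ?_⟩).symm⟩⟩
  · intro a b hab
    rw [powersHom_apply, powersHom_apply, ← Associates.mk_pow, ← Associates.mk_pow,
      associatesMk_eq_iff_valuation_eq, SubmonoidClass.coe_pow, SubmonoidClass.coe_pow, map_pow, map_pow] at hab
    exact Multiplicative.toAdd.injective (pow_right_injective₀ hvπ0 hπ1.ne hab)
  · intro c
    obtain ⟨x, rfl⟩ := Associates.mk_surjective c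
    have hx0 : (x : K) ≠ 0 := x.2.2
    have hex : 0 ≤ e x := (he_le _ hx0).mp x.2.1
    obtain ⟨k, hk⟩ := hdvd _ hx0
    have hk0 : 0 ≤ k := by
      rcases le_or_gt 0 k with h | h
      · exact h
      · exfalso
        have : e π * k < 0 := mul_neg_of_pos_of_neg heπ h
        omega
    refine ⟨Multiplicative.ofAdd k.toNat, ?_⟩
    rw [powersHom_apply, toAdd_ofAdd, ← Associates.mk_pow, associatesMk_eq_iff_valuation_eq,
      SubmonoidClass.coe_pow, he_eq _ _ (pow_ne_zero _ hπ0) hx0, he_pow π hπ0, hk, mul_comm]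
    congr 1
    exact Int.toNat_of_nonneg hk0

/-- `ord(O_K^⊳)` is monoprime ([FrdI] §0) for `K` a finite extension of `ℚ_p` — the hypothesis `hmono` of
t4's `PadicFrd.Datum.zero` for an arbitrary base `D → D₀` of `p`-adic local fields.
[cite: MochizukiFrdII2008, Ex 1.1 (i) p.7] -/
theorem isMonoprime_ordInt
    (hc : ∀ a b : ℚ_[p], algebraMap ℚ_[p] K a ≤ᵥ algebraMap ℚ_[p] K b ↔ a ≤ᵥ b) :
    IsMonoprime (OrdInt K) :=
  IsMonoprime.ofZ (isZMonoprime_ordInt hc)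

end PadicLocal

namespace PadicFld

variable {p : ℕ} [Fact p.Prime]

/-- For an object `Spec K` of `PadicFld p` with `K` a finite extension of `ℚ_p` and its `p`-adic valuation,
`ord(O_K^⊳)` is `ℤ`-monoprime. [cite: MochizukiFrdII2008, Ex 1.1 (i) p.7] -/
theorem isZMonoprime_ordInt (X : PadicFld.{u} p) [Algebra ℚ_[p] X.K] [Module.Finite ℚ_[p] X.K]
    (hc : ∀ a b : ℚ_[p], algebraMap ℚ_[p] X.K a ≤ᵥ algebraMap ℚ_[p] X.K b ↔ a ≤ᵥ b) :
    IsZMonoprime (OrdInt X.K) :=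
  PadicFrd.isZMonoprime_ordInt hc

/-- The monoprime form (hypothesis `hmono` of `Datum.zero`). [cite: MochizukiFrdII2008, Ex 1.1 (i) p.7] -/
theorem isMonoprime_ordInt (X : PadicFld.{u} p) [Algebra ℚ_[p] X.K] [Module.Finite ℚ_[p] X.K]
    (hc : ∀ a b : ℚ_[p], algebraMap ℚ_[p] X.K a ≤ᵥ algebraMap ℚ_[p] X.K b ↔ a ≤ᵥ b) :
    IsMonoprime (OrdInt X.K) :=
  PadicFrd.isMonoprime_ordInt hc

end PadicFld

end PadicFrd

end Literature.AlgebraicGeometry.Frobenioids
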